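import Mathlib
import Summits.NavierStokesRegularity.NavierStokesRegularity.Theorems.StretchingWellBindingEnstrophyQuarterLawSwarmTimes
import HarnessLib

/-!
# Shelf crux `EnstrophyQuarterLaw` (stmt-NavierStokesRegularity-1574), line «sparse_sieve»:
# stub S1's DISSIPATION HALF — the exceptional FINAL TIMES of the parabolic-window enstrophy have measure
# `≤ R E₀/(ν M)` (unconditional, every first blow-up)

Helper file (`--supports stmt-NavierStokesRegularity-1574 --as helper`) for the OPEN registered stub
`stub_uniformLocalTypeI` (S1). Its `E`-half asks, at every final time `b ≤ T` and scale `R ≤ r₀`,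
`∫_{b−R²}^{b} ∫_{B_R(x)} |∇u|² ≤ M R`. Unconditionally, with `Z(t) = ∫ |curl u(t)|²` and `W_R(b) = ∫_{b−R²}^{b} Z`
(which dominates the local quantity for every centre `x`, since `‖∇u‖_op² ≤ |∇u|_F²` and `∫|∇u|_F² = Z`):

* `aemeasurable_enstrophy` — `Z` is a.e.-measurable on `(0,T)` (it is continuous on `[0,T)`);
* `lintegral_window_enstrophy_le` — FUBINI: `∫_{b} W_R(b) db ≤ R² · E₀/ν` over `b ∈ (R², T)`
  (Tonelli on `(b,t)`, each `t` is counted for a `b`-interval of length `R²`, and `∫₀ᵀ Z ≤ E₀/ν`,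
  `setLIntegral_enstrophy_le_lifespan`);
* `volume_windowEnstrophy_exceptionalTimes_le` — MARKOV: the final times `b ∈ (R², T)` with `W_R(b) > M R` have
  measure `≤ R E₀/(ν M)`;
* `volume_localDissipation_exceptionalTimes_le` — hence the final times at which the S1-`E` inequality
  `∫_{b−R²}^{b}∫_{B(x,R)} ‖∇u‖² ≤ M R` fails for SOME centre `x` have measure `≤ R E₀/(ν M)`.

READING (census currency): both halves of S1 (`A`: `…LocalEnergyScale`; `E`: here) and S2 (`SwarmTimes`) fail at
most on time sets of measure `O(R)` — against the parabolic clock `R²`; closing that factor at EVERY time is the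
open content (given stub 6 it is free: `Registered.stub_uniformLocalTypeI_of_stub_noTypeII`). HONEST FRAMING:
elementary unconditional bookkeeping along a HYPOTHETICAL blow-up; S1, S2, 0056, the crux `EnstrophyQuarterLaw`
(1574) and Navier–Stokes regularity stay OPEN; no summit statement is proved.
-/

noncomputable section

-- the summit and its single sub-problem share the name (CONVENTIONS §1), as in every Theorems file
set_option linter.dupNamespace false

namespace Summit.NavierStokesRegularity.NavierStokesRegularity.Theorems.EnstrophyQuarterLaw.EnstrophyScale

open MeasureTheory Set Metric Module
open Literature.Analysis Literature.Analysis.FluidPDE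
open scoped ENNReal NNReal

variable {ν T : ℝ} {u : ℝ → EuclideanSpace ℝ (Fin 3) → EuclideanSpace ℝ (Fin 3)}
  {p : ℝ → EuclideanSpace ℝ (Fin 3) → ℝ}

/-- **The enstrophy `t ↦ ∫ |curl u(t)|²` is a.e.-measurable on `(0,T)`** along a classical solution on `[0,T)`
that is Leray–Hopf from a rapidly decaying datum (it is continuous on `[0,T)` by Tao's Sobolev cover and the
Majda–Bertozzi continuity of the enstrophy). [folklore] -/
theorem aemeasurable_enstrophy (hν : 0 < ν) (hT : 0 < T) (hcl : IsClassicalNSSolutionOn (Ico 0 T) ν 0 u p)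
    (hLH : IsLerayHopfOn T ν 0 (u 0) u) (hdec : HasRapidSpatialDecay (u 0)) :
    AEMeasurable (fun t => ∫⁻ y, ‖curl (u t) y‖ₑ ^ 2) (volume.restrict (Ioo 0 T)) := by
  have hreg : ∀ T'' < T, HasBoundedSobolevNormsOn (Icc 0 T'') u := by
    intro T'' hT''
    by_cases hpos : 0 < T''
    · have hcl₁ : IsClassicalNSSolutionOn (Icc 0 T'') ν 0 u p :=
        hcl.mono (fun s hs => ⟨hs.1, lt_of_le_of_lt hs.2 hT''⟩) (uniqueDiffOn_Icc hpos)
      have hfe : ∃ C' : ℝ≥0, ∀ s ∈ Icc 0 T'', ∫⁻ x, ‖u s x‖ₑ ^ 2 ≤ C' := by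
        refine ⟨(2 * VectorCalculus.kineticEnergy (u 0)).toNNReal, fun s hs => ?_⟩
        have h := hLH.eEnergy_le_datum hν.le (t := s) ⟨hs.1, hs.2.trans hT''.le⟩
        exact h
      exact tao2011_hasBoundedSobolevNormsOn_holds hν hpos hcl₁ hfe hdec
    · intro n
      have hn0 := lintegral_iteratedFDeriv_sq_lt_top hν hcl hLH hdec (t := 0) ⟨le_rfl, hT⟩ n
      refine ⟨(∫⁻ x, ‖iteratedFDeriv ℝ n (u 0) x‖ₑ ^ 2).toNNReal, fun s hs => ?_⟩
      have hs0 : s = 0 := le_antisymm (hs.2.trans (not_lt.1 hpos)) hs.1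
      rw [hs0, ENNReal.coe_toNNReal hn0.ne]
  have hcont := hcl.continuousOn_integral_norm_curl_sq_Ico hreg
  have hZeq : ∀ t ∈ Ioo 0 T, ∫⁻ y, ‖curl (u t) y‖ₑ ^ 2 = ENNReal.ofReal (∫ x, ‖curl (u t) x‖ ^ 2) := by
    intro t ht
    have htI : t ∈ Ico 0 T := ⟨ht.1.le, ht.2⟩
    have hv : ContDiff ℝ 2 (u t) := (hcl.contDiff_velocity htI).of_le (by norm_cast)
    exact lintegral_enorm_curl_sq_eq_ofReal_integral hv (lintegral_iteratedFDeriv_sq_lt_top hν hcl hLH hdec htI 1)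
  have hg : AEMeasurable (fun t => ENNReal.ofReal (∫ x, ‖curl (u t) x‖ ^ 2)) (volume.restrict (Ioo 0 T)) :=
    ENNReal.measurable_ofReal.comp_aemeasurable
      ((hcont.mono fun t ht => ⟨ht.1.le, ht.2⟩).aemeasurable measurableSet_Ioo)
  refine hg.congr ?_
  rw [Filter.EventuallyEq, ae_restrict_iff' measurableSet_Ioo]
  exact Filter.Eventually.of_forall fun t ht => (hZeq t ht).symm

/-- **Fubini for the parabolic windows.** For every window length `h` (of interest: `h = R² > 0`):
`∫_{b ∈ (h, T)} (∫_{t ∈ (b−h, b)} Z(t) dt) db ≤ h · E₀/ν` along a classical solution on `[0,T)` that is Leray–Hopf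
from a rapidly decaying datum (Tonelli: each `t ∈ (0,T)` lies in the window of a `b`-set of measure `≤ h`; then
`∫_{(0,T)} Z ≤ E₀/ν`). [folklore] -/
theorem lintegral_window_enstrophy_le (hν : 0 < ν) (hT : 0 < T)
    (hcl : IsClassicalNSSolutionOn (Ico 0 T) ν 0 u p) (hLH : IsLerayHopfOn T ν 0 (u 0) u)
    (hdec : HasRapidSpatialDecay (u 0)) (h : ℝ) :
    ∫⁻ b in Ioo h T, ∫⁻ t in Ioo (b - h) b, ∫⁻ y, ‖curl (u t) y‖ₑ ^ 2 ≤
      ENNReal.ofReal h * ENNReal.ofReal (VectorCalculus.kineticEnergy (u 0) / ν) := by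
  set Z : ℝ → ℝ≥0∞ := fun t => ∫⁻ y, ‖curl (u t) y‖ₑ ^ 2 with hZ
  set Zx : ℝ → ℝ≥0∞ := (Ioo 0 T).indicator Z with hZx
  have hZxm : AEMeasurable Zx volume :=
    (aemeasurable_indicator_iff measurableSet_Ioo).2 (aemeasurable_enstrophy hν hT hcl hLH hdec)
  set S : Set (ℝ × ℝ) := {q | q.1 - h < q.2 ∧ q.2 < q.1} with hS
  have hSm : MeasurableSet S :=
    (measurableSet_lt (measurable_fst.sub measurable_const) measurable_snd).inter
      (measurableSet_lt measurable_snd measurable_fst)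
  set G : ℝ × ℝ → ℝ≥0∞ := S.indicator fun q => Zx q.2 with hG
  have hGm : AEMeasurable G (volume.prod volume) :=
    (hZxm.comp_quasiMeasurePreserving Measure.quasiMeasurePreserving_snd).indicator hSm
  -- the window integral is dominated by `∫ G(b, ·)`
  have hwin : ∀ b ∈ Ioo h T, ∫⁻ t in Ioo (b - h) b, Z t = ∫⁻ t, G (b, t) := by
    intro b hb
    rw [← lintegral_indicator measurableSet_Ioo]
    refine lintegral_congr fun t => ?_
    by_cases ht : t ∈ Ioo (b - h) b
    · have htT : t ∈ Ioo 0 T := ⟨by linarith [ht.1, hb.1], ht.2.trans hb.2⟩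
      have hq : (b, t) ∈ S := ⟨ht.1, ht.2⟩
      rw [indicator_of_mem ht, hG, indicator_of_mem hq, hZx, indicator_of_mem htT]
    · have hq : (b, t) ∉ S := fun hq => ht ⟨hq.1, hq.2⟩
      rw [indicator_of_notMem ht, hG, indicator_of_notMem hq]
  -- Tonelli
  have hswap : ∫⁻ b, ∫⁻ t, G (b, t) = ∫⁻ t, ∫⁻ b, G (b, t) :=
    lintegral_lintegral_swap (f := fun b t => G (b, t)) hGm
  have hinner : ∀ t, ∫⁻ b, G (b, t) = Zx t * ENNReal.ofReal h := by
    intro t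
    have hset : ∀ b, G (b, t) = (Ioo t (t + h)).indicator (fun _ => Zx t) b := by
      intro b
      by_cases hb : b ∈ Ioo t (t + h)
      · have hq : (b, t) ∈ S := ⟨by linarith [hb.2], hb.1⟩
        rw [hG, indicator_of_mem hq, indicator_of_mem hb]
      · have hq : (b, t) ∉ S := fun hq => hb ⟨hq.2, by linarith [hq.1]⟩
        rw [hG, indicator_of_notMem hq, indicator_of_notMem hb]
    simp_rw [hset]
    rw [lintegral_indicator measurableSet_Ioo, setLIntegral_const, Real.volume_Ioo,
      show t + h - t = h by ring]
  calc ∫⁻ b in Ioo h T, ∫⁻ t in Ioo (b - h) b, Z t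
      = ∫⁻ b in Ioo h T, ∫⁻ t, G (b, t) := setLIntegral_congr_fun measurableSet_Ioo hwin
    _ ≤ ∫⁻ b, ∫⁻ t, G (b, t) := setLIntegral_le_lintegral _ _
    _ = ∫⁻ t, Zx t * ENNReal.ofReal h := by rw [hswap]; exact lintegral_congr hinner
    _ = ENNReal.ofReal h * ∫⁻ t, Zx t := by
        rw [lintegral_mul_const'' _ hZxm, mul_comm]
    _ = ENNReal.ofReal h * ∫⁻ t in Ioo 0 T, Z t := by rw [hZx, lintegral_indicator measurableSet_Ioo]
    _ ≤ ENNReal.ofReal h * ENNReal.ofReal (VectorCalculus.kineticEnergy (u 0) / ν) :=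
        mul_le_mul' le_rfl (setLIntegral_enstrophy_le_lifespan hν hT hcl hLH hdec)

/-- **Markov: the exceptional final times of the window enstrophy.** For every classical solution on `[0,T)` that
is Leray–Hopf from a rapidly decaying datum, `M > 0`, `R > 0`: the final times `b ∈ (R², T)` with
`∫_{b−R²}^{b} Z > M R` have measure `≤ R E₀/(ν M)`. [folklore] -/
theorem volume_windowEnstrophy_exceptionalTimes_le (hν : 0 < ν) (hT : 0 < T)
    (hcl : IsClassicalNSSolutionOn (Ico 0 T) ν 0 u p) (hLH : IsLerayHopfOn T ν 0 (u 0) u)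
    (hdec : HasRapidSpatialDecay (u 0)) {M R : ℝ} (hM : 0 < M) (hR : 0 < R) :
    volume {b ∈ Ioo (R ^ 2) T |
      ENNReal.ofReal (M * R) < ∫⁻ t in Ioo (b - R ^ 2) b, ∫⁻ y, ‖curl (u t) y‖ₑ ^ 2} ≤
      ENNReal.ofReal (R * VectorCalculus.kineticEnergy (u 0) / (ν * M)) := by
  set Z : ℝ → ℝ≥0∞ := fun t => ∫⁻ y, ‖curl (u t) y‖ₑ ^ 2 with hZ
  set μ : Measure ℝ := volume.restrict (Ioo (R ^ 2) T) with hμ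
  set W : ℝ → ℝ≥0∞ := fun b => ∫⁻ t in Ioo (b - R ^ 2) b, Z t with hW
  -- a.e.-measurability of `W` on `(R², T)` via the product representation
  set Zx : ℝ → ℝ≥0∞ := (Ioo 0 T).indicator Z with hZx
  have hZxm : AEMeasurable Zx volume :=
    (aemeasurable_indicator_iff measurableSet_Ioo).2 (aemeasurable_enstrophy hν hT hcl hLH hdec)
  set S : Set (ℝ × ℝ) := {q | q.1 - R ^ 2 < q.2 ∧ q.2 < q.1} with hS
  have hSm : MeasurableSet S :=
    (measurableSet_lt (measurable_fst.sub measurable_const) measurable_snd).inter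
      (measurableSet_lt measurable_snd measurable_fst)
  set G : ℝ × ℝ → ℝ≥0∞ := S.indicator fun q => Zx q.2 with hG
  have hGm : AEMeasurable G (volume.prod volume) :=
    (hZxm.comp_quasiMeasurePreserving Measure.quasiMeasurePreserving_snd).indicator hSm
  have hwin : ∀ b ∈ Ioo (R ^ 2) T, W b = ∫⁻ t, G (b, t) := by
    intro b hb
    simp only [hW]
    rw [← lintegral_indicator measurableSet_Ioo]
    refine lintegral_congr fun t => ?_
    by_cases ht : t ∈ Ioo (b - R ^ 2) b
    · have htT : t ∈ Ioo 0 T := ⟨by linarith [ht.1, hb.1], ht.2.trans hb.2⟩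
      have hq : (b, t) ∈ S := ⟨ht.1, ht.2⟩
      rw [indicator_of_mem ht, hG, indicator_of_mem hq, hZx, indicator_of_mem htT]
    · have hq : (b, t) ∉ S := fun hq => ht ⟨hq.1, hq.2⟩
      rw [indicator_of_notMem ht, hG, indicator_of_notMem hq]
  have hWm : AEMeasurable W μ := by
    have h1 : AEMeasurable (fun b => ∫⁻ t, G (b, t)) volume := hGm.lintegral_prod_right'
    refine (h1.restrict.congr ?_)
    rw [Filter.EventuallyEq, ae_restrict_iff' measurableSet_Ioo]
    exact Filter.Eventually.of_forall fun b hb => (hwin b hb).symm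
  -- Markov
  have hmarkov := mul_meas_ge_le_lintegral₀ hWm (ENNReal.ofReal (M * R))
  have hint : ∫⁻ b, W b ∂μ ≤ ENNReal.ofReal (R ^ 2) * ENNReal.ofReal (VectorCalculus.kineticEnergy (u 0) / ν) :=
    lintegral_window_enstrophy_le hν hT hcl hLH hdec (R ^ 2)
  have hMR : 0 < M * R := by positivity
  have hmeas_le : μ {b | ENNReal.ofReal (M * R) ≤ W b} ≤
      ENNReal.ofReal (R ^ 2) * ENNReal.ofReal (VectorCalculus.kineticEnergy (u 0) / ν) /
        ENNReal.ofReal (M * R) := by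
    rw [ENNReal.le_div_iff_mul_le (Or.inl ((ENNReal.ofReal_pos.2 hMR).ne'))
      (Or.inl ENNReal.ofReal_ne_top), mul_comm]
    exact hmarkov.trans hint
  have hE0 : 0 ≤ VectorCalculus.kineticEnergy (u 0) := kineticEnergy_nonneg _
  calc volume {b ∈ Ioo (R ^ 2) T | ENNReal.ofReal (M * R) < W b}
      ≤ volume ({b | ENNReal.ofReal (M * R) ≤ W b} ∩ Ioo (R ^ 2) T) :=
        measure_mono fun b hb => ⟨le_of_lt hb.2, hb.1⟩
    _ ≤ μ {b | ENNReal.ofReal (M * R) ≤ W b} := Measure.le_restrict_apply _ _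
    _ ≤ ENNReal.ofReal (R ^ 2) * ENNReal.ofReal (VectorCalculus.kineticEnergy (u 0) / ν) /
        ENNReal.ofReal (M * R) := hmeas_le
    _ = ENNReal.ofReal (R * VectorCalculus.kineticEnergy (u 0) / (ν * M)) := by
        rw [← ENNReal.ofReal_mul (by positivity), ← ENNReal.ofReal_div_of_pos hMR]
        congr 1
        field_simp

/-- **The exceptional final times of stub S1's dissipation half have measure `O(R/M)`.** For every classical
solution on `[0,T)` that is Leray–Hopf from a rapidly decaying datum, `M > 0`, `R > 0`: the final times
`b ∈ (R², T)` at which `∫_{b−R²}^{b} ∫_{B(x,R)} ‖∇u‖_op² > M R` for SOME centre `x` have measure `≤ R E₀/(ν M)`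
(`‖∇u‖_op² ≤ |∇u|_F²`, `∫|∇u|_F² = Z`, then `volume_windowEnstrophy_exceptionalTimes_le`). [folklore] -/
theorem volume_localDissipation_exceptionalTimes_le (hν : 0 < ν) (hT : 0 < T)
    (hcl : IsClassicalNSSolutionOn (Ico 0 T) ν 0 u p) (hLH : IsLerayHopfOn T ν 0 (u 0) u)
    (hdec : HasRapidSpatialDecay (u 0)) {M R : ℝ} (hM : 0 < M) (hR : 0 < R) :
    volume {b ∈ Ioo (R ^ 2) T | ∃ x : EuclideanSpace ℝ (Fin 3), ENNReal.ofReal (M * R) <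
      ∫⁻ t in Ioo (b - R ^ 2) b, ∫⁻ y in ball x R, ‖fderiv ℝ (u t) y‖ₑ ^ 2} ≤
      ENNReal.ofReal (R * VectorCalculus.kineticEnergy (u 0) / (ν * M)) := by
  refine le_trans (measure_mono ?_) (volume_windowEnstrophy_exceptionalTimes_le hν hT hcl hLH hdec hM hR)
  rintro b ⟨hb, x, hx⟩
  refine ⟨hb, lt_of_lt_of_le hx ?_⟩
  -- `∫_{window} ∫_{ball} ‖∇u‖² ≤ ∫_{window} Z`
  refine setLIntegral_mono' measurableSet_Ioo fun t ht => ?_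
  have htI : t ∈ Ico 0 T := ⟨by linarith [ht.1, hb.1], ht.2.trans hb.2⟩
  have hn := lintegral_iteratedFDeriv_sq_lt_top hν hcl hLH hdec htI
  have hv : ContDiff ℝ 2 (u t) := (hcl.contDiff_velocity htI).of_le (by norm_cast)
  have h0 : ∫⁻ y, ‖u t y‖ₑ ^ 2 < ⊤ := by
    refine lt_of_le_of_lt (le_of_eq (lintegral_congr fun y => ?_)) (hn 0)
    rw [← ofReal_norm, ← norm_iteratedFDeriv_zero (𝕜 := ℝ) (f := u t), ofReal_norm]
  calc ∫⁻ y in ball x R, ‖fderiv ℝ (u t) y‖ₑ ^ 2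
      ≤ ∫⁻ y, ‖fderiv ℝ (u t) y‖ₑ ^ 2 := setLIntegral_le_lintegral _ _
    _ ≤ ∫⁻ y, ENNReal.ofReal (frobeniusNormSq (fderiv ℝ (u t) y)) := by
        refine lintegral_mono fun y => ?_
        rw [← ofReal_norm, ← ENNReal.ofReal_pow (norm_nonneg _)]
        exact ENNReal.ofReal_le_ofReal (sq_opNorm_le_frobeniusNormSq _)
    _ = ∫⁻ y, ‖curl (u t) y‖ₑ ^ 2 :=
        lintegral_frobeniusNormSq_fderiv_eq_lintegral_curl_sq hv (hcl.divFree t htI) h0 (hn 1) (hn 2)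

end Summit.NavierStokesRegularity.NavierStokesRegularity.Theorems.EnstrophyQuarterLaw.EnstrophyScale

end
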